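import Summits.ABC.IUTFork.Joshi.ArithmeticoidCollation
import Mathlib.Topology.Algebra.Group.Basic
import Mathlib.Topology.Instances.Int

/-!
# [J-II½] Prop. 7.5.1 — the two readings of «all the isomorphisms … provided by Proposition 7.4.1»: structural facts and a
# kernel witness that they DIFFER (proof-only companion of `Joshi/ArithmeticoidCollation.lean`)

Proof-only companion file of the abc-iut cell, branch E (rung LADDER-ABC:A2.E; seat abc-iut-E-t38, slot T-38); no new claim,
no frozen import (E-PLAN R14). SOURCE and locators as in `Joshi/ArithmeticoidCollation.lean` (K. Joshi, arXiv:2305.10398v12,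
UNREFEREED; bib `Joshi2023ATS2half`). **No side is taken** on [IUTchIII] Cor. 3.12, on Joshi's claims, or on Mochizuki's
report on them; typed ≠ proved; a located ambiguity is not a verdict on any author.

WHAT IS PROVED. `Joshi/ArithmeticoidCollation.lean` types the collation `Ψ_{X,A}` of Prop. 7.5.1 (p.49 l.6–11) along two
candidate families of factorwise isomorphisms, both compatible with the printed sentence «under all the isomorphisms (of
topological groups) of each factor of H^1(arith(L)_y, ℤ(1)) ≃ H^1(arith(L)_{y₀}, ℤ(1)) provided by Proposition 7.4.1»:
reading N (`CohomologyDatum.providedIsos`: the isomorphisms induced by anabelomorphisms of the local Galois groups through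
[J-I] Thm. 8.4.1 (1), as in the PROOF of Prop. 7.4.1 p.48 l.43–46 and in [J-I] Cor. 8.5.1 p.46 l.22–26) and reading W
(`allTopIsos`: every isomorphism of topological groups of the factor, the sentence read literally), with N ⊆ W. Here:
1. (§1) reading W is closed under composition with ANY automorphism of topological groups of the standard factors — in
   particular under inversion `x ↦ x⁻¹` of each factor (`inv_mem_allTopIsos`, `collationAll_translate_subset`): the
   W-collation is a union of orbits of `∏_v Aut_{top.grp}(H^1(arith(L)_{y₀})_v)`;
2. (§2) the two readings are NOT the same notion: in an explicit toy factor (trivial local Galois group, cohomology group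
   `ℤ` written multiplicatively with its discrete topology, `coh` = identity) inversion is a W-isomorphism that is not an
   N-isomorphism (`Toy.providedIsos_ssubset_allTopIsos`), and the W-collation of a single class strictly contains its
   N-collation (`Toy.collationProvided_ssubset_collationAll`).
WHY IT MATTERS FOR THE CELL (dictionary row D-10, «collation isomorphisms ↦ ⟨(Ind1) ∪ (Ind2)⟩», second half of the residual
`AnsatzWithinInd`; consumers E-t18 `DictionaryCollation`, E-t22, E-cx): whichever reading a test binds, the kernel now records
that the choice is material — W admits every topological-group automorphism of `H^1 ≅ lim L_v^×/L_v^{×p^n}` (Prop. 7.2.2 (2)),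
N only Galois-induced ones. Which reading print intends is a question for the faithfulness lane (E-ref), not decided here.
Standard axioms only; sorry-free. [claim: Joshi2023ATS2half, status: disputed]
-/

set_option autoImplicit false

noncomputable section

open Set

namespace Summit.ABC.IUTFork.Joshi.ATS2half

universe u

/-! ## 1. Closure properties of reading W -/

section ReadingW

variable {V : Type u} {Pt : V → Type u} (H : ℕ → (v : V) → Pt v → Type u) [∀ i v y, CommGroup (H i v y)]
  [∀ i v y, TopologicalSpace (H i v y)]

/-- The identity of a factor is a W-isomorphism. [folklore] -/
theorem refl_mem_allTopIsos (i : ℕ) (v : V) (a : Pt v) : Equiv.refl (H i v a) ∈ allTopIsos H i v a a :=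
  ⟨continuous_id, continuous_id, fun _ _ => rfl⟩

/-- W-isomorphisms compose: an allowed isomorphism `a → b` followed by an allowed isomorphism `b → c` is allowed `a → c`.
[folklore] -/
theorem trans_mem_allTopIsos {i : ℕ} {v : V} {a b c : Pt v} {e : H i v a ≃ H i v b} {e' : H i v b ≃ H i v c}
    (he : e ∈ allTopIsos H i v a b) (he' : e' ∈ allTopIsos H i v b c) : e.trans e' ∈ allTopIsos H i v a c :=
  ⟨he'.1.comp he.1, he.2.1.comp he'.2.1, fun x x' => by simp [Equiv.trans_apply, he.2.2 x x', he'.2.2]⟩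

/-- W-isomorphisms invert. [folklore] -/
theorem symm_mem_allTopIsos {i : ℕ} {v : V} {a b : Pt v} {e : H i v a ≃ H i v b} (he : e ∈ allTopIsos H i v a b) :
    e.symm ∈ allTopIsos H i v b a := by
  refine ⟨he.2.1, he.1, fun x x' => e.injective ?_⟩
  rw [he.2.2, e.apply_symm_apply, e.apply_symm_apply, e.apply_symm_apply]

/-- In a factor whose inversion is continuous (any topological group), INVERSION `x ↦ x⁻¹` is a W-isomorphism of the factor
with itself — an automorphism of topological groups that no anabelomorphism need induce. [folklore] -/
theorem inv_mem_allTopIsos (i : ℕ) (v : V) (a : Pt v) [ContinuousInv (H i v a)] :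
    (MulEquiv.inv (H i v a)).toEquiv ∈ allTopIsos H i v a a :=
  ⟨continuous_inv, continuous_inv, fun x x' => mul_inv x x'⟩

variable {H}
variable {IsArc : Set V} {G : (v : V) → Pt v → Type u} [∀ v y, Group (G v y)] [∀ v y, TopologicalSpace (G v y)]

/-- **The W-collation is stable under `∏_v Aut_{top.grp}`**: post-composing every factor of a collated class with a
W-automorphism of the standard factor stays inside the W-collation (by `trans_mem_allTopIsos`). [folklore] -/
theorem collationAll_translate_subset (𝔠 : CohomologyDatum H IsArc G) (i : ℕ) (A : Set (∀ v, Pt v))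
    (Ψ : ∀ y : (∀ v, Pt v), Set (CohArith H i y)) (f : ∀ v, H i v (𝔠.std v) ≃ H i v (𝔠.std v))
    (hf : ∀ v, f v ∈ allTopIsos H i v (𝔠.std v) (𝔠.std v)) :
    (fun c v => f v (c v)) '' 𝔠.collationAll i A Ψ ⊆ 𝔠.collationAll i A Ψ := by
  rintro _ ⟨c', ⟨y, hy, c, hc, e, he, hc'⟩, rfl⟩
  exact ⟨y, hy, c, hc, fun v => (e v).trans (f v), fun v => trans_mem_allTopIsos H (he v) (hf v),
    fun v => by simp [Equiv.trans_apply, hc' v]⟩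

/-- In particular the W-collation is stable under factorwise INVERSION of the standard cohomology (each factor a topological
group). [folklore] -/
theorem collationAll_inv_subset (𝔠 : CohomologyDatum H IsArc G) (i : ℕ) (A : Set (∀ v, Pt v))
    (Ψ : ∀ y : (∀ v, Pt v), Set (CohArith H i y)) [∀ v, ContinuousInv (H i v (𝔠.std v))] :
    (fun c v => (c v)⁻¹) '' 𝔠.collationAll i A Ψ ⊆ 𝔠.collationAll i A Ψ :=
  collationAll_translate_subset 𝔠 i A Ψ (fun v => (MulEquiv.inv (H i v (𝔠.std v))).toEquiv)
    fun v => inv_mem_allTopIsos H i v (𝔠.std v)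

end ReadingW

/-! ## 2. A toy factor in which reading N is STRICTLY narrower than reading W -/

namespace Toy

/-- Toy local parameter spaces: one place (`Unit`), one point. [folklore] -/
abbrev Pt : Unit → Type := fun _ => Unit

/-- Toy cohomology: every group `= ℤ` written multiplicatively, with the (discrete) topology of `ℤ`. [folklore] -/
abbrev H : ℕ → (v : Unit) → Pt v → Type := fun _ _ _ => Multiplicative ℤ

/-- Toy local Galois groups: trivial. [folklore] -/
abbrev G : (v : Unit) → Pt v → Type := fun _ _ => Unit

/-- The toy cohomology datum: no archimedean place, standard point the unique point, and `coh` sends the (unique)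
anabelomorphism of the trivial group to the identity of the factor. [folklore] -/
def datum : CohomologyDatum (Pt := Pt) H (∅ : Set Unit) G where
  canonicalFibre _ := Set.univ
  std _ := ()
  std_mem _ _ := Set.mem_univ _
  coh _ _ _ _ _ := ContinuousMulEquiv.refl _

/-- In the toy factor every N-isomorphism is the identity. [folklore] -/
theorem mem_providedIsos_iff (i : ℕ) (e : H i () () ≃ H i () ()) :
    e ∈ datum.providedIsos i () () () ↔ e = Equiv.refl _ := by
  constructor
  · rintro ⟨α, rfl⟩
    rfl
  · rintro rfl
    exact ⟨ContinuousMulEquiv.refl _, rfl⟩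

/-- Inversion of the toy factor is not the identity (`-1 ≠ 1` in `ℤ`). [folklore] -/
theorem inv_ne_refl (i : ℕ) : (MulEquiv.inv (H i () ())).toEquiv ≠ Equiv.refl _ := by
  intro h
  have h1 := congrArg (fun e : H i () () ≃ H i () () => Multiplicative.toAdd (e (Multiplicative.ofAdd (1 : ℤ)))) h
  simp at h1

/-- Inversion of the toy factor is a W-isomorphism (an automorphism of topological groups). [folklore] -/
theorem inv_mem_allTopIsos_toy (i : ℕ) : (MulEquiv.inv (H i () ())).toEquiv ∈ allTopIsos H i () () () :=
  ⟨continuous_of_discreteTopology, continuous_of_discreteTopology, fun x x' => mul_inv x x'⟩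

/-- **Reading N ⊊ reading W in the toy factor**: inversion is an isomorphism of topological groups of the factor that no
anabelomorphism induces. [folklore] -/
theorem providedIsos_ssubset_allTopIsos (i : ℕ) : datum.providedIsos i () () () ⊂ allTopIsos H i () () () := by
  rw [Set.ssubset_def]
  exact ⟨datum.providedIsos_subset_allTopIsos i _ _ _,
    fun h => inv_ne_refl i ((mem_providedIsos_iff i _).1 (h (inv_mem_allTopIsos_toy i)))⟩

/-- **The collations differ too**: collating the single class `1 ∈ ℤ` (multiplicatively `ofAdd 1`) of the single
arithmeticoid, the N-collation does not contain the inverted class `-1`, while the W-collation does. [folklore] -/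
theorem collationProvided_ssubset_collationAll (i : ℕ) :
    datum.collationProvided i {fun _ => ()} (fun _ => {fun _ => Multiplicative.ofAdd (1 : ℤ)}) ⊂
      datum.collationAll i {fun _ => ()} (fun _ => {fun _ => Multiplicative.ofAdd (1 : ℤ)}) := by
  rw [Set.ssubset_def]
  refine ⟨datum.collationProvided_subset_collationAll i _ _, fun h => ?_⟩
  -- the inverted class lies in the W-collation …
  have hW : (fun _ : Unit => (Multiplicative.ofAdd (1 : ℤ))⁻¹) ∈
      datum.collationAll i {fun _ => ()} (fun _ => {fun _ => Multiplicative.ofAdd (1 : ℤ)}) :=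
    ⟨fun _ => (), rfl, fun _ => Multiplicative.ofAdd (1 : ℤ), rfl, fun _ => (MulEquiv.inv (H i () ())).toEquiv,
      fun _ => inv_mem_allTopIsos_toy i, fun _ => rfl⟩
  -- … but every N-collated class equals the original class
  obtain ⟨y, -, c, hc, e, he, hc'⟩ := h hW
  have hc1 : c = fun _ => Multiplicative.ofAdd (1 : ℤ) := hc
  have he1 : e () = Equiv.refl _ := (mem_providedIsos_iff i _).1 (he ())
  have h2 : (Multiplicative.ofAdd (1 : ℤ))⁻¹ = e () (c ()) := hc' ()
  rw [he1, hc1] at h2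
  have h3 := congrArg Multiplicative.toAdd h2
  simp at h3

end Toy

end Summit.ABC.IUTFork.Joshi.ATS2half

end
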